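/-
Copyright (c) 2026 the pub-hodgecm-mathlib formalisation cell (harness21).  Prover seat hodgecm-mathlib-LH4-p19 (g0), req620 Track A «(D-RAM) FOUR-FRAME» squad
(STAGE-1b, row (2) of the piece `f_{T₊}`, the (β₂) road (R-36) «PURE-CELL LEDGER»; the diagonal cell below the clean line, row (L-D♭) «D balanced for
`2 ≤ δ ≤ 2d − 2`», mechanism memo `F0/P3c/LH4/LH4-p19/g0/MECH-LDflat.v1.LH4p19g0.md` 8f57960d), 2026-09-04.
-/
import Mathlib.Algebra.BigOperators.Ring.Finset
import HarnessLib

/-!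
# Crux `H413`, line LH4 «(D-RAM) FOUR-FRAME» — STAGE-1b, row (2), the (β₂) road (R-36), row (L-D♭), the ABSTRACT HALF: «A CELL IS BALANCED WHEN THE LITERAL HALVES
# EVERY LABEL-FIBRE» — pure finite counting, no field, no lattice

Cell `hodgecm-mathlib` (D-0151), FLOOR 0, crux item H413 = `stmt-HodgeConjecture-24833`, route of record `HCCMUnconditional`; squad F0∕P3c∕LH4; lane
`--supports stmt-HodgeConjecture-24833 --as helper` (count-neutral; pays NO tier-0 row).  THEOREMS ONLY (no `def`, no instance, no notation, no `sorry`, default heartbeats).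

WHY (MECH-LDflat v1 §2–§4; reduced models `dcell_d4.v1` ∕ `charsum_d4.v1`, this seat).  Below the clean line (`2 ≤ δ ≤ 2d − 2`) the diagonal cone cell `D` of the (β₂) ledger is
BALANCED on each literal, but NOT through a fixed flip of the line model (★ p861154 ∕ ★ p860839): in the coordinates `(T, V)` of `1∕κ` the LITERAL predicate (the `N_{M∕K♮}`-coset,
`χ_E(V² − V + 1) = c_t`) takes each value on exactly HALF of every orbit `V₀ + 𝔭_F^{d−g}` of the tail-digit shifts, while the LABEL `χ_E(1 − γV)` (`v_F(γ) = g = δ∕2`) is CONSTANT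
on those orbits and globally balanced (`Σ_V χ_E(1 − γV) = 0`, conductor `d > d − g`).  THIS FILE is the counting skeleton of that argument, datum-free:
* §1 `two_mul_card_filter_filter_eq_of_fibre_halving` — if on every fibre of `π : X → Y` inside the finite cell `S` the literal `L` holds on exactly half the members
  (`2·#{x ∈ S ∣ πx = y ∧ L x} = #{x ∈ S ∣ πx = y}`), then `L` halves EVERY `π`-saturated part of `S`: `2·#{x ∈ S ∣ Φ(πx) ∧ L x} = #{x ∈ S ∣ Φ(πx)}`.
* §2 HEAD `card_filter_filter_eq_of_fibre_halving` — with a fibre-constant label `ψ ∘ π` that is balanced on the cell (`#{ψ} = #{¬ψ}`), the literal sub-cell is balanced too: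
  `#{x ∈ S ∣ L x ∧ ψ(πx)} = #{x ∈ S ∣ L x ∧ ¬ψ(πx)}` — the `cellDiff_t(D) = 0` shape of ★ p861305 §3 once the consumer identifies `S` = the populated-or-not diagonal cell
  presented by `(T, V, fibre)`, `π` = «forget the tail digits of `V`», `L` = the literal's coset predicate, `ψ` = the label class.
* §3 `card_filter_eq_card_filter_not_of_fibre_const` — the balance of `ψ` on `S` from the balance of `ψ` on the base `Y`-set when all `π`-fibres have the same size
  (the consumer gets the base balance from the character sum `Σ χ_E(1 − γV₀) = 0`).
WHAT IS NOT HERE: the presentation of `D` by `(T, V)` and the three dictionaries (literal ∕ populated ∕ label) — the lattice half of (L-D♭), OPEN.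
HONEST LABEL.  Count-neutral finite counting; nothing printed is asserted; no census law is stated; `HC_CM` is proved only modulo the 7 printed citations (2 remaining named inputs:
hLiu418 = `stmt-HodgeConjecture-24832`, h413 = `stmt-HodgeConjecture-24833`) until rung 0 closes.
## References
* [Kottwitz1986BaseChangeUnits] R. E. Kottwitz, *Base change for unit elements of Hecke algebras*, Compositio Math. 60 (1986): §1 pp. 240–241 (fixed-lattice counts as orbital integrals).
* [Rogawski1990] J. D. Rogawski, *Automorphic Representations of Unitary Groups in Three Variables*, Ann. of Math. Stud. 123 (1990): §4.9 Prop. 4.9.1 (b) p. 55, §12.2 (κ-signed counts).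
* [Serre1979] J.-P. Serre, *Local Fields*, GTM 67 (1979): Ch. XV §2 (conductor of a quadratic character; character sums over `(1 + 𝔭^g)∕(1 + 𝔭^d)`).
-/

set_option autoImplicit false

namespace Summit.HodgeConjecture.HodgeConjecture.Cruxes.H413.F0P3cDyRamCellBalanceOfFibreHalving

open Finset

variable {X Y : Type*} [DecidableEq Y]

/-! ## §1 The literal halves every label-saturated part of the cell -/

/-- **A `π`-SATURATED PART OF THE CELL IS THE UNION OF ITS FIBRES**: `#{x ∈ S ∣ Φ(πx) ∧ p x} = Σ_{y ∈ π(S), Φ y} #{x ∈ S ∣ πx = y ∧ p x}` (★ Mathlib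
`sum_card_fiberwise_eq_card_filter`). [cite: Kottwitz1986BaseChangeUnits, §1 pp. 240–241] -/
theorem card_filter_comp_filter_eq_sum (S : Finset X) (π : X → Y) (Φ : Y → Prop) [DecidablePred Φ] (p : X → Prop) [DecidablePred p] :
    ((S.filter fun x => Φ (π x)).filter p).card = ∑ y ∈ (S.image π).filter Φ, ((S.filter p).filter fun x => π x = y).card := by
  rw [sum_card_fiberwise_eq_card_filter (S.filter p) ((S.image π).filter Φ) π]
  congr 1
  ext x
  simp only [mem_filter, mem_image]
  constructor
  · rintro ⟨⟨hxS, hΦ⟩, hp⟩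
    exact ⟨⟨hxS, hp⟩, ⟨x, hxS, rfl⟩, hΦ⟩
  · rintro ⟨⟨hxS, hp⟩, -, hΦ⟩
    exact ⟨⟨hxS, hΦ⟩, hp⟩

/-- **THE LITERAL HALVES EVERY LABEL-SATURATED PART.**  If on every `π`-fibre of the finite cell `S` the literal `L` holds on exactly half the members
(`2·#{x ∈ S ∣ L x ∧ πx = y} = #{x ∈ S ∣ πx = y}` for all `y`), then for every predicate `Φ` of the FIBRE: `2·#{x ∈ S ∣ Φ(πx) ∧ L x} = #{x ∈ S ∣ Φ(πx)}`.
[cite: Kottwitz1986BaseChangeUnits, §1 pp. 240–241] [cite: Rogawski1990, §4.9 Prop. 4.9.1 (b) p. 55] -/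
theorem two_mul_card_filter_filter_eq_of_fibre_halving (S : Finset X) (π : X → Y) (L : X → Prop) [DecidablePred L]
    (hhalf : ∀ y, 2 * ((S.filter L).filter fun x => π x = y).card = (S.filter fun x => π x = y).card)
    (Φ : Y → Prop) [DecidablePred Φ] :
    2 * ((S.filter fun x => Φ (π x)).filter L).card = (S.filter fun x => Φ (π x)).card := by
  have h1 := card_filter_comp_filter_eq_sum S π Φ L
  have h2 := card_filter_comp_filter_eq_sum S π Φ (fun _ => True)
  rw [filter_true_of_mem (fun _ _ => trivial)] at h2
  simp only [filter_true_of_mem (fun _ _ => trivial)] at h2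
  rw [h1, h2, Finset.mul_sum]
  exact sum_congr rfl fun y _ => hhalf y

/-! ## §2 HEAD — a balanced fibre-constant label stays balanced on the literal sub-cell -/

/-- **HEAD — «A CELL IS BALANCED WHEN THE LITERAL HALVES EVERY LABEL-FIBRE».**  Finite cell `S`, fibre map `π : X → Y`, literal `L` holding on exactly half of every
fibre (`hhalf`), label `ψ ∘ π` constant on fibres and balanced on the cell (`hbal : #{x ∈ S ∣ ψ(πx)} = #{x ∈ S ∣ ¬ψ(πx)}`).  THEN the literal sub-cell is balanced:
`#{x ∈ S ∣ ψ(πx) ∧ L x} = #{x ∈ S ∣ ¬ψ(πx) ∧ L x}` — the abstract shape of (L-D♭) `cellDiff_t(D) = 0` below the clean line (MECH-LDflat v1 §3).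
[cite: Kottwitz1986BaseChangeUnits, §1 pp. 240–241] [cite: Rogawski1990, §4.9 Prop. 4.9.1 (b) p. 55] [cite: Serre1979, Ch. XV §2] -/
theorem card_filter_filter_eq_of_fibre_halving (S : Finset X) (π : X → Y) (L : X → Prop) [DecidablePred L]
    (hhalf : ∀ y, 2 * ((S.filter L).filter fun x => π x = y).card = (S.filter fun x => π x = y).card)
    (ψ : Y → Prop) [DecidablePred ψ]
    (hbal : (S.filter fun x => ψ (π x)).card = (S.filter fun x => ¬ ψ (π x)).card) :
    ((S.filter fun x => ψ (π x)).filter L).card = ((S.filter fun x => ¬ ψ (π x)).filter L).card := by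
  have h1 := two_mul_card_filter_filter_eq_of_fibre_halving S π L hhalf ψ
  have h2 := two_mul_card_filter_filter_eq_of_fibre_halving S π L hhalf (fun y => ¬ ψ y)
  omega

/-! ## §3 The label balance on the cell from the label balance on the base -/

/-- **CONSTANT FIBRES TRANSPORT THE BASE BALANCE**: if every `π`-fibre of `S` over the base set `B` has the same size `k` and `π(S) ⊆ B`, then
`#{x ∈ S ∣ Φ(πx)} = k·#{y ∈ B ∣ Φ y}`; hence `#{y ∈ B ∣ ψ y} = #{y ∈ B ∣ ¬ψ y}` (the base balance, e.g. from a character sum) gives `#{x ∈ S ∣ ψ(πx)} = #{x ∈ S ∣ ¬ψ(πx)}`.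
[cite: Serre1979, Ch. XV §2] [cite: Kottwitz1986BaseChangeUnits, §1 pp. 240–241] -/
theorem card_filter_comp_eq_mul_of_fibre_const (S : Finset X) (π : X → Y) (B : Finset Y) (hB : ∀ x ∈ S, π x ∈ B) (k : ℕ)
    (hk : ∀ y ∈ B, (S.filter fun x => π x = y).card = k) (Φ : Y → Prop) [DecidablePred Φ] :
    (S.filter fun x => Φ (π x)).card = k * (B.filter Φ).card := by
  have hmaps : ((S.filter fun x => Φ (π x)) : Set X).MapsTo π (B.filter Φ) := by
    intro x hx
    rw [mem_coe, mem_filter] at hx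
    rw [mem_coe, mem_filter]
    exact ⟨hB x hx.1, hx.2⟩
  rw [card_eq_sum_card_fiberwise hmaps]
  have hfib : ∀ y ∈ B.filter Φ, ((S.filter fun x => Φ (π x)).filter fun x => π x = y).card = k := by
    intro y hy
    rw [mem_filter] at hy
    rw [← hk y hy.1]
    congr 1
    ext x
    simp only [mem_filter]
    constructor
    · rintro ⟨⟨hxS, -⟩, hxy⟩; exact ⟨hxS, hxy⟩
    · rintro ⟨hxS, hxy⟩; exact ⟨⟨hxS, by rw [hxy]; exact hy.2⟩, hxy⟩
  rw [sum_const_nat hfib, mul_comm]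

/-- **BALANCE ON THE BASE ⟹ BALANCE ON THE CELL** (constant fibre size). [cite: Serre1979, Ch. XV §2] -/
theorem card_filter_eq_card_filter_not_of_fibre_const (S : Finset X) (π : X → Y) (B : Finset Y) (hB : ∀ x ∈ S, π x ∈ B) (k : ℕ)
    (hk : ∀ y ∈ B, (S.filter fun x => π x = y).card = k) (ψ : Y → Prop) [DecidablePred ψ]
    (hbase : (B.filter ψ).card = (B.filter fun y => ¬ ψ y).card) :
    (S.filter fun x => ψ (π x)).card = (S.filter fun x => ¬ ψ (π x)).card := by
  rw [card_filter_comp_eq_mul_of_fibre_const S π B hB k hk ψ, card_filter_comp_eq_mul_of_fibre_const S π B hB k hk (fun y => ¬ ψ y), hbase]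

/-! ## §4 (appended) Balance from a label-reversing self-map (the source of `hhalf` and `hbase` in the consumer: multiplication by a fixed non-norm unit) -/

/-- **A LABEL-REVERSING INJECTIVE SELF-MAP BALANCES THE LABEL.**  If `τ : X → X` maps the finite set `B` into itself, is injective on `B`, and REVERSES the label
(`ψ(τ y) ↔ ¬ψ y` on `B`), then `#{y ∈ B ∣ ψ y} = #{y ∈ B ∣ ¬ψ y}`.  (Consumer: `B` = a coset of `(1 + 𝔭^g)∕(1 + 𝔭^d)` or a tail-digit orbit, `τ` = multiplication by a
fixed unit of the subgroup on which `χ_E` is `−1`, `ψ = (χ_E = +1)` — this yields both the fibre halving `hhalf` of §1 and the base balance `hbase` of §3.)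
[cite: Serre1979, Ch. XV §2] [cite: Kottwitz1986BaseChangeUnits, §1 pp. 240–241] -/
theorem card_filter_eq_card_filter_not_of_labelReversing (B : Finset X) (τ : X → X) (hτB : ∀ y ∈ B, τ y ∈ B) (hτi : Set.InjOn τ B)
    (ψ : X → Prop) [DecidablePred ψ] (hrev : ∀ y ∈ B, (ψ (τ y) ↔ ¬ ψ y)) :
    (B.filter ψ).card = (B.filter fun y => ¬ ψ y).card := by
  apply le_antisymm
  · refine card_le_card_of_injOn τ (fun y hy => ?_) (hτi.mono (coe_subset.2 (filter_subset _ _)))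
    rw [mem_coe, mem_filter] at hy ⊢
    exact ⟨hτB y hy.1, fun h => absurd ((hrev y hy.1).1 h) (not_not.2 hy.2)⟩
  · refine card_le_card_of_injOn τ (fun y hy => ?_) (hτi.mono (coe_subset.2 (filter_subset _ _)))
    rw [mem_coe, mem_filter] at hy ⊢
    exact ⟨hτB y hy.1, by_contra fun h => hy.2 (by simpa using (not_iff_not.2 (hrev y hy.1)).1 h)⟩

/-- **TWICE THE LABELLED PART IS THE WHOLE** — the `hhalf` shape of §1 from a label-reversing self-map: `2·#{y ∈ B ∣ ψ y} = #B`. [cite: Serre1979, Ch. XV §2] -/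
theorem two_mul_card_filter_eq_card_of_labelReversing (B : Finset X) (τ : X → X) (hτB : ∀ y ∈ B, τ y ∈ B) (hτi : Set.InjOn τ B)
    (ψ : X → Prop) [DecidablePred ψ] (hrev : ∀ y ∈ B, (ψ (τ y) ↔ ¬ ψ y)) :
    2 * (B.filter ψ).card = B.card := by
  have h := card_filter_eq_card_filter_not_of_labelReversing B τ hτB hτi ψ hrev
  have h2 := card_filter_add_card_filter_not (s := B) ψ
  omega

end Summit.HodgeConjecture.HodgeConjecture.Cruxes.H413.F0P3cDyRamCellBalanceOfFibreHalving
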